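import Summits.KontsevichZagierPeriods.KontsevichZagierPeriods.Theses.WickWedge

/-!
# Crux `ComplexDescent` (stmt-KontsevichZagierPeriods-6842, route WickWedge, rank 6) — `Lines/birth.lean`

BIRTH SKELETON (BC3) of the thesis conjunct

  `ComplexDescent` : `∀ c : KZ.FormalRep, inclC (incl c) ∈ KZexpC.relations → c ∈ KZ.relations`

(a `ℤ`-combination of CLASSICAL representations which is a relation of the complex-phase exponential
calculus `KZexpC` — representations `[σ, f, g, θ]`, value `∫_σ e^{-g-iθ} f`, the five moves with
complex primitives `Σ hᵢ e^{-gᵢ-iθᵢ}` — is already a KZ relation; elementwise form of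
`KZexpC.relations.comap (inclC.comp KZexp.incl) ≤ KZ.relations`, `KZexpC.comap_inclC_incl_le_iff`).

## The cut: descend along the tower `KZ ⟶ KZexp ⟶ KZexpC`, one exponential factor at a time

The composite inclusion factors through the REAL-weight exponential calculus `KZexp`
(`[σ, f] ↦ [σ, f, 0] ↦ [σ, ↑f, 0, 0]`), and so does the descent problem. Three registered stubs:

* `stub_soundC` (provable-class, size L — the complex twin of the landed
  `KZexp.relations_le_ker_eval_holds`, i.e. the sibling proof file `KZExpCCalculusProofs.lean`
  announced in `KZExpCCalculus.lean` but ABSENT from the tree): the five complex moves preserve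
  values, `KZexpC.relations ≤ KZexpC.eval.ker` (additivity of the Bochner integral, the Jacobian
  formula, Fubini + the fundamental theorem of calculus for `ℂ`-valued fibre primitives
  `Σ hᵢ e^{-gᵢ-iθᵢ}`, and `MeasureTheory.integral_Ioi_of_hasDerivAt_of_tendsto` for (3b)). It is what
  makes the value hypothesis of the next stub free, and what every refutation-side use of the crux
  (witness ⇒ `¬ KZKernelConjecture`) silently assumes.
* `stub_phaseDescent` (open; the content SPECIFIC to this crux — oscillatory phases `e^{-iθ}`,
  `cos 1 ∉ ℚ̄`): a complex chain between CLASSICAL endpoints of total value `0` can be replaced by a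
  PHASE-FREE chain, i.e. it lands in the real exponential calculus:
  `inclC (incl c) ∈ KZexpC.relations → KZ.eval c = 0 → incl c ∈ KZexp.relations`. Strictly between
  the crux and nothing: implied by `ComplexDescent` (`phaseDescent_of_complexDescent`), it does NOT
  give the crux without weight descent. It is NOT the real conservativity `ConservativeCR`
  (`KZexpC.relations.comap inclC ≤ KZexp.relations`, all real-exponential endpoints), which this
  route's own bet (SumRuleSixC derivable, SumRuleSixExp possibly not) speaks against; only classical
  endpoints are asked to descend. Tools on record: `KZexpC.conjMap` (relations are conjugation-stable,
  `conjMap_mem_relations_iff`, and `inclC`-images are conjugation-fixed, `conjMap_inclC`), the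
  phase-zero-locus retraction `[σ, f, g, θ] ↦ [{θ = 0}, Re f, g]` (handles the three
  Newton–Leibniz-free moves exactly as `KZexp.zeroLocusRetraction` does; the content sits in (3a)/(3b)
  where the phase varies along the fibre — the Wick wedge).
* `stub_weightDescent` (open) = `KZexp.Conservative` VERBATIM, i.e. item
  stmt-KontsevichZagierPeriods-0530 (`ExpConservative.ExpConservativityV2`, staffed by route
  ExpConservative; negation item 0535): a real-exponential chain between classical endpoints can be
  replaced by a KZ chain (kill the weights `e^{-g}`, `e^{-1} ∉ ℚ̄`; content again in (3a)/(3b),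
  `KZexp.conservative_nlFree`).

Composition `ComplexDescent_of` (fully proved, four lines): soundness makes `KZ.eval c = 0` automatic
(`KZexpC.eval_inclC_incl`, `Complex.ofReal_eq_zero`), phase descent puts `incl c` in
`KZexp.relations`, weight descent puts `c` in `KZ.relations`. Honest strength bookkeeping (all
proved below): `ComplexDescent → stub_phaseDescent ∧ stub_weightDescent` unconditionally, and
`stub_soundC → (ComplexDescent ↔ stub_phaseDescent ∧ stub_weightDescent)`; so the two open stubs
are each a NECESSARY condition of the crux and jointly (given the provable soundness) equivalent to
it — neither alone is the crux or the summit (BC3 probes `stub → ComplexDescent`,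
`stub → KontsevichZagierPeriods` by `first | exact? | simpa | aesop`: all fail, registrar folder
`bc/probe_*.lean`).

Disproof used: none on record — `ledger crux ls stmt-KontsevichZagierPeriods-6842` shows no
`Disproof.lean` / Negative lemma for this crux; the summit's negatives index has one unrelated entry
(KinematicPlaneConvex, `K = ∅`). Degenerate data: `c = 0` satisfies every stub's hypotheses and
conclusions (`zero_mem`); a nonzero KZ relation `c` satisfies the hypothesis of `stub_phaseDescent`
non-vacuously (`KZexpC.map_relations_incl_le`) and its conclusion (`KZexp.map_relations_le`).

References: M. Kontsevich, D. Zagier, *Periods* (2001), §1.2 Conjecture 1, §4.3 (exponential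
periods) [KontsevichZagierPeriods2001]; J. Fresán, P. Jossen, *Exponential motives* (ms.), Thm 5.1.1 /
Prop 5.1.3 / Cor 5.1.4 (classical Nori motives fully faithful inside exponential ones: the motivic
shadow of both descent stubs) [FresanJossen2020]; J. Commelin, P. Habegger, A. Huber, *Exponential
periods and o-minimality*, arXiv:2007.08280, Def 2 / Thm 3 [CommelinHabeggerHuber2020]; J. Fresán,
C. Sabbah, J.-D. Yu, *Quadratic relations between Bessel moments*, arXiv:2006.02702, Cor 7 / Rem 8
[FresanSabbahYu2023].
-/

noncomputable section

set_option linter.dupNamespace false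

open Literature.NumberTheory.Transcendental

namespace Summit.KontsevichZagierPeriods.KontsevichZagierPeriods.Cruxes.ComplexDescent.Birth

/-! ## Registered stubs -/

/-- **STUB (provable-class, size L) — soundness of the five complex moves.** Every relation of the
complex-phase exponential calculus has value `0`: `KZexpC.relations ≤ KZexpC.eval.ker`. The complex
twin of `KZexp.relations_le_ker_eval_holds` (`KZExpCalculusProofs.lean`, 56 KB): (1a)/(1b) additivity
of the set integral, (2) `MeasureTheory.integral_image_eq_integral_abs_det_fderiv_smul`, (3a) Fubini
over the base and `intervalIntegral.integral_eq_sub_of_hasDerivAt_of_le` on each fibre for the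
`ℂ`-valued primitive `KZexpC.expSum h g θ`, (3b) `MeasureTheory.integral_Ioi_of_hasDerivAt_of_tendsto`
with the limit hypothesis. Announced as the sibling proof file `KZExpCCalculusProofs.lean` in the
docstring of `KZExpCCalculus.lean` but not in the tree; used as the hypothesis `hs` of
`KZexpC.comap_inclC_incl_le_of_kzKernelConjecture` / `comap_inclC_incl_le_iff_of_sound`. Why it might
fail: it does not (each move is an identity of absolutely convergent integrals); the risk is size
(measurability of semialgebraic data on bands, a.e.-fibre integrability).
[cite: KontsevichZagierPeriods2001, §1.2 rules 1-3, §4.3] -/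
theorem stub_soundC :
    Literature.NumberTheory.Transcendental.KZexpC.relations ≤ Literature.NumberTheory.Transcendental.KZexpC.eval.ker := by
  sorry

/-- **STUB (open; the crux-specific half) — phase descent between classical endpoints.** If a
`ℤ`-combination `c` of classical representations, of total value `0`, is a relation of the
complex-phase calculus, then its image `incl c` in the REAL exponential calculus is already a real
exponential relation: the oscillatory factors `e^{-iθ}` of the intermediate representations of a
complex chain (Wick wedges, monodromy families `K₀(te^{iα})`) can be eliminated when both ends are
phase- and weight-free. Necessary for the crux (`phaseDescent_of_complexDescent`); with
`stub_weightDescent` and soundness equivalent to it (`complexDescent_iff_of_sound`). Deliberately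
weaker than real conservativity `KZexpC.relations.comap inclC ≤ KZexp.relations`
(`KZexpC.comap_inclC_le_iff`), which asks ALL real-exponential endpoints to descend and which the
route's corpus bet (SumRuleSixC ∈ KZexpC.relations while SumRuleSixExp may fail in KZexp) argues
against. The value hypothesis `KZ.eval c = 0` is free under `stub_soundC` and is there for the prover
(sign splitting / normal forms of a vanishing classical combination). Why it might fail: a complex
Stokes chain between classical endpoints whose every real shadow needs a non-semialgebraic primitive
(`cos (r sin φ)`), i.e. the real calculus is too small exactly on the incl-image — granted soundness
and `KZexp.KernelConjecture` restricted to `incl`-images it cannot. Foothold: the phase-zero-locus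
retraction `[σ, f, g, θ] ↦ [{x ∈ σ | θ x = 0}, Re f, g]` splits `inclC` and handles the three
Newton–Leibniz-free complex moves (as `KZexp.zeroLocusRetraction` does for weights), so the content
lies in (3a)/(3b) with fibrewise-varying phase. [cite: KontsevichZagierPeriods2001, §4.3]
[cite: FresanJossen2020, Thm 5.1.1] -/
theorem stub_phaseDescent :
    ∀ c : Literature.NumberTheory.Transcendental.KZ.FormalRep,
      Literature.NumberTheory.Transcendental.KZexpC.inclC (Literature.NumberTheory.Transcendental.KZexp.incl c) ∈
          Literature.NumberTheory.Transcendental.KZexpC.relations →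
        Literature.NumberTheory.Transcendental.KZ.eval c = 0 →
          Literature.NumberTheory.Transcendental.KZexp.incl c ∈ Literature.NumberTheory.Transcendental.KZexp.relations := by
  sorry

/-- **STUB (open; shared) — weight descent = `KZexp.Conservative`**, VERBATIM item
stmt-KontsevichZagierPeriods-0530 of route ExpConservative (`ExpConservativeV2`; also 0292; negation
0535): a `ℤ`-combination of classical representations which is a relation of the real exponential
calculus is a KZ relation, `∀ c : KZ.FormalRep, incl c ∈ KZexp.relations → c ∈ KZ.relations`. Kill
the weights `e^{-g}` (`e^{-1} ∉ ℚ̄`; `Γ`-detours `1 = ∫₀^∞ e^{-t} dt`); the Newton–Leibniz-free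
fragment is proved (`KZexp.conservative_nlFree`, zero-locus retraction), the content lies in
(3a)/(3b). Necessary for the crux (`weightDescent_of_complexDescent` =
`KZexpC.conservative_of_comap_inclC_incl_le`). Why it might fail: parametric weight-`0` (3b)
instances and `Γ`-detours with no coefficient retraction; mod soundness false only together with
`KZKernelConjecture`. [cite: KontsevichZagierPeriods2001, §4.3] [cite: FresanJossen2020, Thm 5.1.1] -/
theorem stub_weightDescent : Literature.NumberTheory.Transcendental.KZexp.Conservative := by
  sorry

/-! ## The stubs in the vocabulary of the Literature file (kernel-checked identifications)

`stub_weightDescent` is literally the constant `KZexp.Conservative`, i.e. the signature of item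
stmt-KontsevichZagierPeriods-0530 (`Theses.ExpConservative.ExpConservativityV2 := KZexp.Conservative`,
not imported here to keep the skeleton's cone inside route WickWedge). -/

example : (KZexpC.relations ≤ KZexpC.eval.ker) ↔
    ∀ c : KZexpC.FormalRep, c ∈ KZexpC.relations → KZexpC.eval c = 0 :=
  ⟨fun h _ hc => (AddMonoidHom.mem_ker).1 (h hc), fun h _ hc => (AddMonoidHom.mem_ker).2 (h _ hc)⟩

example : KZexp.Conservative ↔
    ∀ c : KZ.FormalRep, KZexp.incl c ∈ KZexp.relations → c ∈ KZ.relations :=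
  Iff.rfl

/-! ## Composition (fully proved): the three stubs imply the crux BY NAME

Two theorems conclude `Theses.WickWedge.ComplexDescent` by name: `ComplexDescent_of` in the registrar's
shape `<stub signatures> → ComplexDescent` (the signatures inline, verbatim those of the three stubs), and
`complexDescent_of_stubs : ComplexDescent`, which feeds it the stubs BY NAME and is the theorem the
mechanical `#h21_check_skeleton` audit takes as the skeleton (it admits only registered obligations as
hypotheses; dry run in the registrar's folder: ok, theorem = `complexDescent_of_stubs`, 3 stubs, 3 sorries). -/

/-- **`ComplexDescent_of`**: soundness of the complex moves, phase descent between classical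
endpoints and weight descent (`KZexp.Conservative`) imply the crux `WickWedge.ComplexDescent`.
Given a classical `c` with `inclC (incl c) ∈ KZexpC.relations`: by soundness its value
`↑(KZ.eval c)` vanishes (`KZexpC.eval_inclC_incl`), so `KZ.eval c = 0`; phase descent gives
`incl c ∈ KZexp.relations`; weight descent gives `c ∈ KZ.relations`.
[cite: KontsevichZagierPeriods2001, §1.2, §4.3] -/
theorem ComplexDescent_of :
    (Literature.NumberTheory.Transcendental.KZexpC.relations ≤
        Literature.NumberTheory.Transcendental.KZexpC.eval.ker) →
    (∀ c : Literature.NumberTheory.Transcendental.KZ.FormalRep,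
        Literature.NumberTheory.Transcendental.KZexpC.inclC (Literature.NumberTheory.Transcendental.KZexp.incl c) ∈
            Literature.NumberTheory.Transcendental.KZexpC.relations →
          Literature.NumberTheory.Transcendental.KZ.eval c = 0 →
            Literature.NumberTheory.Transcendental.KZexp.incl c ∈
              Literature.NumberTheory.Transcendental.KZexp.relations) →
    Literature.NumberTheory.Transcendental.KZexp.Conservative →
      Summit.KontsevichZagierPeriods.KontsevichZagierPeriods.Theses.WickWedge.ComplexDescent := by
  intro hs hθ hg c hc
  have h0 : KZexpC.eval (KZexpC.inclC (KZexp.incl c)) = 0 := (AddMonoidHom.mem_ker).1 (hs hc)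
  rw [KZexpC.eval_inclC_incl, Complex.ofReal_eq_zero] at h0
  exact hg c (hθ c hc h0)

/-- The crux from the stubs themselves (a lead closing the three stubs closes the item).
[cite: KontsevichZagierPeriods2001, §1.2, §4.3] -/
theorem complexDescent_of_stubs :
    Summit.KontsevichZagierPeriods.KontsevichZagierPeriods.Theses.WickWedge.ComplexDescent :=
  ComplexDescent_of stub_soundC stub_phaseDescent stub_weightDescent

/-! ## Honest strength bookkeeping (fully proved): each open stub is a necessary condition of the crux -/

/-- The crux implies phase descent: a KZ relation is a real exponential relation
(`KZexp.map_relations_le`). [folklore] -/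
theorem phaseDescent_of_complexDescent
    (h : Summit.KontsevichZagierPeriods.KontsevichZagierPeriods.Theses.WickWedge.ComplexDescent) :
    ∀ c : KZ.FormalRep, KZexpC.inclC (KZexp.incl c) ∈ KZexpC.relations → KZ.eval c = 0 →
      KZexp.incl c ∈ KZexp.relations :=
  fun c hc _ => KZexp.map_relations_le ⟨c, h c hc, rfl⟩

/-- The crux implies weight descent (`KZexpC.conservative_of_comap_inclC_incl_le`: a real relation
is a complex relation, `KZexpC.inclC_mem_relations`). [folklore] -/
theorem weightDescent_of_complexDescent
    (h : Summit.KontsevichZagierPeriods.KontsevichZagierPeriods.Theses.WickWedge.ComplexDescent) :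
    KZexp.Conservative :=
  fun c hc => h c (KZexpC.inclC_mem_relations hc)

/-- Under soundness of the complex moves the crux is EXACTLY the conjunction of the two open stubs
(the cut loses nothing and adds nothing). [folklore] -/
theorem complexDescent_iff_of_sound (hs : KZexpC.relations ≤ KZexpC.eval.ker) :
    Summit.KontsevichZagierPeriods.KontsevichZagierPeriods.Theses.WickWedge.ComplexDescent ↔
      (∀ c : KZ.FormalRep, KZexpC.inclC (KZexp.incl c) ∈ KZexpC.relations → KZ.eval c = 0 →
          KZexp.incl c ∈ KZexp.relations) ∧ KZexp.Conservative :=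
  ⟨fun h => ⟨phaseDescent_of_complexDescent h, weightDescent_of_complexDescent h⟩,
    fun h => ComplexDescent_of hs h.1 h.2⟩

/-- Degenerate-data check: the zero combination satisfies hypotheses and conclusion of
`stub_phaseDescent` (no vacuity from the value hypothesis). [folklore] -/
example : KZexpC.inclC (KZexp.incl (0 : KZ.FormalRep)) ∈ KZexpC.relations ∧
    KZ.eval (0 : KZ.FormalRep) = 0 ∧ KZexp.incl (0 : KZ.FormalRep) ∈ KZexp.relations := by
  simp only [map_zero]
  exact ⟨zero_mem _, trivial, zero_mem _⟩

/-- Non-vacuity: every KZ relation `c` (e.g. any move instance) satisfies the hypothesis of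
`stub_phaseDescent` (`KZexpC.map_relations_incl_le`) — and its conclusion. [folklore] -/
example (c : KZ.FormalRep) (hc : c ∈ KZ.relations) :
    KZexpC.inclC (KZexp.incl c) ∈ KZexpC.relations ∧ KZexp.incl c ∈ KZexp.relations :=
  ⟨KZexpC.map_relations_incl_le ⟨c, hc, rfl⟩, KZexp.map_relations_le ⟨c, hc, rfl⟩⟩

end Summit.KontsevichZagierPeriods.KontsevichZagierPeriods.Cruxes.ComplexDescent.Birth

end
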